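/-
HONEST FRAMING: certified error envelopes and provably optimal rounding/accumulation schemes for
low-precision formats under stated cost models; every table by two implementations; no hardware
or vendor claims.
-/
import Summits.Ventures.CertifiedArithmetic.LowPrec.OptDemotionRoutingConeQ4
import Summits.Ventures.CertifiedArithmetic.LowPrec.OptDemotionRoutingConeQ5

/-!
# The demotion law (Theorem T8), part 9g: Statement-style R4 propositions for parts 9a–9f

Same shape as `OptDemotionBudgetR4.lean` (part 7e): the cone-closure principle and its two
kernel-certified instances (opt gen 14 C36/C37) as named `Prop`s with their `_holds` discharges, for
the venture's rung bookkeeping (OPTIMA.md §B T8(b)(iii)/(iii⁗), COST-MODELS CM-B).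
-/

namespace Summit.Ventures.CertifiedArithmetic.LowPrec.Opt

open Literature.ComputerArithmetic.JeannerodRump2018
open Literature.ComputerArithmetic.JeannerodRump2018.SumTree
open Cone

/-- R4 (Opt, CM-B demote, OPTIMA T8(b)(iii⁗)) THE CONE-CLOSURE PRINCIPLE: for every precision
`q ≥ 2`, split data passing `dataValid q`, an integer row list every row of which has a passing
certificate tree (`rowCheck`), and weights passing `ttCheck q`, opt's two-tree inequality `TT q`
holds — hence Conjecture D for every summation tree at precision `q` (part 8n). -/
def R4_ConeClosurePrinciple : Prop :=
  ∀ (q : ℕ) (data : List (List (Part × Part))) (rows : List (List ℤ)) (rho : List (ℕ × ℕ)),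
    2 ≤ q → dataValid q data = true → (∀ r ∈ rows, ∃ c, rowCheck q rows data r c = true) →
      ttCheck q rows rho = true → TT q

/-- Discharge of `R4_ConeClosurePrinciple` by `TT_of_checks` ∘ `tab_inCone` (parts 9c, 9d). -/
theorem R4_ConeClosurePrinciple_holds : R4_ConeClosurePrinciple :=
  fun _ _ _ _ hq hdata hrows htt =>
    TT_of_checks htt (tab_inCone (le_trans (by norm_num) hq) hdata hrows)

/-- R4 (Opt, CM-B demote, OPTIMA T8(b)(iii⁗) R20) opt's TWO-TREE INEQUALITY AT q = 4 AND q = 5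
(until now certified numerically, C33; here by the kernel-checked cone-closure certificates C36/C37). -/
def R4_TwoTreeInequalityQ4Q5 : Prop := TT 4 ∧ TT 5

/-- Discharge of `R4_TwoTreeInequalityQ4Q5` (parts 9f). -/
theorem R4_TwoTreeInequalityQ4Q5_holds : R4_TwoTreeInequalityQ4Q5 := ⟨TT_four, TT_five⟩

/-- R4 (Opt, CM-B demote, OPTIMA T8(b)(iii)) CONJECTURE D FOR EVERY SUMMATION TREE AT PRECISIONS
q = 4 AND q = 5: for every `p ≥ 1`, any nearest roundings `fl` into `F(q, emin)` and `flp` into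
`F(p, emin)`, every summation tree `t` of nonnegative `F(q, emin)` data satisfies
`s ≤ Q_t(u_q, u_p) · fl_p(ŝ)` — no restriction on the shape or the number of summands.  (With the
every-tree witness `demotion_tree_witness` of part 4 this is exact: `D_t = Q_t`.) -/
def R4_DemotionLawEveryTreeQ4Q5 : Prop :=
  (∀ (p : ℕ) (emin : ℤ) (fl flp : ℚ → ℚ), 1 ≤ p → IsRoundNearest 4 emin fl →
    IsRoundNearest p emin flp → ∀ t : SumTree, (∀ x ∈ leaves t, IsFloat 4 emin x ∧ 0 ≤ x) →
      exact t ≤ treeQf (unitRoundoff 4) t (unitRoundoff p) * flp (eval fl t)) ∧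
  (∀ (p : ℕ) (emin : ℤ) (fl flp : ℚ → ℚ), 1 ≤ p → IsRoundNearest 5 emin fl →
    IsRoundNearest p emin flp → ∀ t : SumTree, (∀ x ∈ leaves t, IsFloat 5 emin x ∧ 0 ≤ x) →
      exact t ≤ treeQf (unitRoundoff 5) t (unitRoundoff p) * flp (eval fl t))

/-- Discharge of `R4_DemotionLawEveryTreeQ4Q5` by `conjectureD_q4` / `conjectureD_q5` (parts 9f). -/
theorem R4_DemotionLawEveryTreeQ4Q5_holds : R4_DemotionLawEveryTreeQ4Q5 :=
  ⟨fun _ _ _ _ hp hfl hflp t ht => conjectureD_q4 hp hfl hflp t ht,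
   fun _ _ _ _ hp hfl hflp t ht => conjectureD_q5 hp hfl hflp t ht⟩

/-- The routing conjecture `W = BR` (part 8e `RoutingBound`) for EVERY shape at q = 4 and q = 5. -/
theorem routingBound_q4_q5 (s : Shape) : RoutingBound 4 s ∧ RoutingBound 5 s :=
  ⟨routingBound_q4 s, routingBound_q5 s⟩

end Summit.Ventures.CertifiedArithmetic.LowPrec.Opt
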